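import Literature.AlgebraicGeometry.HodgeTheory.ZariskiClosedStraightening
import HarnessLib

/-!
# Zariski-closed subsets of smooth complex varieties are locally flat in `X(ℂ)` off a closed subset of larger codimension — the non-projective case (Serre, GAGA §6 Cor. 3; Voisin I, Thm. 11.11)

Companion of `HodgeTheory/ZariskiClosedStraightening`, which proves, for `X` smooth PROJECTIVE
over `ℂ` and `Z ⊆ X` Zariski-closed with every point of codimension `≥ c`, the existence of a
Zariski-closed `Z₁ ⊆ Z` of codimension `≥ c + 1` off which `Z(ℂ)` is straightened in `X(ℂ)` by
open partial homeomorphisms `X(ℂ) ⇀ ℂ^{c'} × K` (`GAGADimension.exists_closed_straightening_off`; one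
step of the filtration of C. Voisin, *Hodge Theory and Complex Algebraic Geometry I* (2002),
Thm. 11.11, by Serre's comparison at simple points, GAGA §6 Cor. 3). Projectivity enters that proof
only through integrality, smoothness of relative dimension `n` and the finiteness of codimensions;
this file records the SAME theorem and proof for every integral `ℂ`-scheme smooth of relative
dimension `n` over `ℂ` (`exists_closed_straightening_off_of_smooth`, with its pointwise form
`exists_straightening_of_witnesses_of_smooth`), as needed for the semipurity of the coniveau
filtration on the (non-compact) total space of a smooth family over a smooth quasi-projective base
(`SingularHomology/SupportPropagation`, hypothesis (S1)). The algebraic lemmas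
(`simplePointData_of_isRegularLocalRing`, `isRegularLocalRing_of_mem_smoothLocus`, …) are those of
`ZariskiClosedStraightening`, imported.

Everything is proved; no definitions, no named facts.

## References

* [SerreGAGA1956] J.-P. Serre, Géométrie algébrique et géométrie analytique, Ann. Inst. Fourier 6
  (1956), §1 n°4, §2 n°6 Prop. 3 Cor. 2, §6 Prop. 3 Cor. 3 (p. 11).
* [VoisinHodgeI2002] C. Voisin, Hodge Theory and Complex Algebraic Geometry I, CUP 2002, §11.1.1
  Thm. 11.11, §11.1.2 Lemma 11.13.
* [GortzWedhorn2020] U. Görtz, T. Wedhorn, Algebraic Geometry I, 2nd ed. 2020, Thm. 6.19,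
  Lemma 6.26 (generic smoothness).
-/

noncomputable section

open scoped Manifold ContDiff Topology
open CategoryTheory AlgebraicGeometry Filter IsLocalRing
open Literature.AlgebraicGeometry.Motives
open Literature.AlgebraicGeometry.Motives.AlgPoints (evalOrZero evalOrZero_of_mem evalOrZero_of_not_mem)
open Literature.NumberTheory.Transcendental

namespace Literature.AlgebraicGeometry.HodgeTheory

namespace GAGADimension

/-! ### The straightening chart at a good complex point -/

section Point

variable {n : ℕ} {X : SchemeOver ℂ}

/-- **A good complex point of `Z` is straightened** (Serre, GAGA §6 Cor. 3 at a simple point, in the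
tree's algebraic-chart model of `X^h`, followed by the holomorphic implicit function theorem) —
the statement of `exists_straightening_of_witnesses` (`ZariskiClosedStraightening`) with "smooth
projective" weakened to what its proof uses. Let `X` be an integral `ℂ`-scheme smooth of relative
dimension `n` over `ℂ`, `Z ⊆ X` a subset, `U = Spec A` an affine open
with `A` standard smooth of relative dimension `n` over `ℂ` (canonical scalars), `𝔭 ⊂ A` a prime of
height `c` with `g₁, …, g_c ∈ 𝔭`, `h' · 𝔭 ⊆ (g)`, and such that off `V(h)` a point of `U` lies in
`Z` iff it lies in `V(𝔭)`. Let `P` be a complex point of `U` with `(h h')(P) ≠ 0` whose maximal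
ideal `𝔪_P = ker (evaluation at P)` is the contraction of a prime `x` of `A/𝔭` at which `A/𝔭` is
regular. Then `Z(ℂ) = {Q | pt Q ∈ Z}` is straightened at `P`: there are a subspace `K ⊆ ℂⁿ` and an
open partial homeomorphism `e : X(ℂ) ⇀ ℂᶜ × K` with `P ∈ e.source` and `pt Q ∈ Z ↔ (e Q).1 = 0` on
`e.source`. Proof: the simple-point data at `𝔪_P` (`simplePointData_of_isRegularLocalRing`) make `P`
a regular point of codimension `c` of `Z(ℂ)` for the algebraic-chart atlas
(`isRegularPointOfCodim_of_simplePoint`, `exists_algebraicChart_holds`), and regular points are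
locally flat (`IsRegularPointOfCodim.exists_straightening`).
[cite: SerreGAGA1956, §6 Prop. 3 Cor. 2–3 (p. 11) with §1 n°4 and §2 n°6 Cor. 2] -/
theorem exists_straightening_of_witnesses_of_smooth [IsIntegral X.left]
    [SmoothOfRelativeDimension n X.hom] {Z : Set X.left}
    (U : X.left.affineOpens)
    (hsm : RingHom.IsStandardSmoothOfRelativeDimension n (SchemeOver.scalarRingHom X ↑U))
    (𝔭 : Ideal Γ(X.left, ↑U)) [𝔭.IsPrime] {c : ℕ} (hc : (c : ℕ∞) = 𝔭.height)
    (g : Fin c → Γ(X.left, ↑U)) (hg : ∀ j, g j ∈ 𝔭) (h h' : Γ(X.left, ↑U))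
    (hgen : ∀ a ∈ 𝔭, h' * a ∈ Ideal.span (Set.range g))
    (hiso : ∀ q : PrimeSpectrum Γ(X.left, ↑U), h ∉ q.asIdeal →
      (U.2.fromSpec.base q ∈ Z ↔ 𝔭 ≤ q.asIdeal))
    (P : ComplexPoints X) (hPU : P.pt ∈ (↑U : X.left.Opens))
    (x : PrimeSpectrum (Γ(X.left, ↑U) ⧸ 𝔭))
    (hx : x.asIdeal.comap (Ideal.Quotient.mk 𝔭) = RingHom.ker (P.evalRingHom ↑U hPU))
    (hreg : IsRegularLocalRing (Localization.AtPrime x.asIdeal))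
    (hhP : P.eval ↑U hPU (h * h') ≠ 0) :
    ∃ (K : Submodule ℂ (Fin n → ℂ))
      (e : OpenPartialHomeomorph (ComplexPoints X) ((Fin c → ℂ) × K)),
      P ∈ e.source ∧ ∀ Q ∈ e.source, Q.pt ∈ Z ↔ (e Q).1 = 0 := by
  classical
  have hU : IsAffineOpen (↑U : X.left.Opens) := U.2
  -- instances on `X` and on `A = Γ(X, U)`
  haveI : LocallyOfFiniteType X.hom := by
    haveI : Smooth X.hom := SmoothOfRelativeDimension.smooth n _
    infer_instance
  letI : Algebra ℂ Γ(X.left, ↑U) := (SchemeOver.scalarRingHom X ↑U).toAlgebra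
  haveI : Algebra.IsStandardSmoothOfRelativeDimension n ℂ Γ(X.left, ↑U) := hsm
  haveI : Nonempty (↑U : X.left.Opens) := ⟨⟨P.pt, hPU⟩⟩
  haveI : IsDomain Γ(X.left, ↑U) := IsIntegral.component_integral (↑U : X.left.Opens)
  haveI : Algebra.IsStandardSmooth ℂ Γ(X.left, ↑U) :=
    Algebra.IsStandardSmoothOfRelativeDimension.isStandardSmooth n
  haveI : IsNoetherianRing Γ(X.left, ↑U) := Algebra.FiniteType.isNoetherianRing ℂ _
  -- the rational point `ψ = evaluation at P`, with kernel `𝔪_P`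
  let ψ : Γ(X.left, ↑U) →ₐ[ℂ] ℂ :=
    { P.evalRingHom ↑U hPU with
      commutes' := fun a ↦ by
        change P.evalRingHom ↑U hPU (SchemeOver.scalarRingHom X ↑U a) = a
        rw [AlgPoints.evalRingHom_apply, AlgPoints.eval_scalarRingHom]
        rfl }
  have hkerψ : RingHom.ker ψ = RingHom.ker (P.evalRingHom ↑U hPU) := rfl
  have hh'P : P.eval ↑U hPU h' ≠ 0 := fun h0 ↦ hhP (by
    rw [← AlgPoints.evalRingHom_apply, map_mul, AlgPoints.evalRingHom_apply,
      AlgPoints.evalRingHom_apply, h0, mul_zero])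
  have hhP₁ : P.eval ↑U hPU h ≠ 0 := fun h0 ↦ hhP (by
    rw [← AlgPoints.evalRingHom_apply, map_mul, AlgPoints.evalRingHom_apply, h0, zero_mul])
  have hh'ψ : h' ∉ RingHom.ker ψ := by
    rw [hkerψ, RingHom.mem_ker, AlgPoints.evalRingHom_apply]
    exact hh'P
  obtain ⟨hindep, t, ht, htspan⟩ := simplePointData_of_isRegularLocalRing ℂ Γ(X.left, ↑U) n 𝔭 hc
    g hg h' hgen ψ x (by rw [hkerψ]; exact hx) hreg hh'ψ
  have h𝔭𝔪 : 𝔭 ≤ RingHom.ker (P.evalRingHom ↑U hPU) := by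
    rw [← hx]
    intro a ha
    change Ideal.Quotient.mk 𝔭 a ∈ x.asIdeal
    rw [Ideal.Quotient.eq_zero_iff_mem.2 ha]
    exact zero_mem _
  -- the model `X(ℂ)` of `X^h` with algebraic charts
  choose chart mem alg hol using fun Q : ComplexPoints X ↦ exists_algebraicChart_holds X n Q
  letI cs : ChartedSpace (Fin n → ℂ) (ComplexPoints X) := chartedSpaceOfCharts chart mem
  haveI hM₀ : IsManifold 𝓘(ℂ, Fin n → ℂ) ω (ComplexPoints X) :=
    isManifold_chartedSpaceOfCharts chart mem alg hol
  haveI : IsManifold 𝓘(ℂ, Fin n → ℂ) 1 (ComplexPoints X) := IsManifold.of_le le_top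
  have hid : IsAnalytification (Fin n → ℂ) X n (id : ComplexPoints X → ComplexPoints X) := by
    refine ⟨IsHomeomorph.id, by simp, ?_⟩
    intro V s m hm
    simp only [Set.preimage_id_eq, id_eq, Set.mem_setOf_eq] at hm
    refine MDifferentiableAt.mdifferentiableWithinAt ?_
    rw [mdifferentiableAt_iff]
    refine ⟨(AlgPoints.continuousOn_evalOrZero _ s).continuousAt
      ((AlgPoints.isOpen_setOf_pt_mem _).mem_nhds hm), ?_⟩
    simp only [writtenInExtChartAt, extChartAt, OpenPartialHomeomorph.extend,
      modelWithCornersSelf_partialEquiv, PartialEquiv.trans_refl, modelWithCornersSelf_coe,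
      Set.range_id, OpenPartialHomeomorph.toFun_eq_coe,
      OpenPartialHomeomorph.coe_toPartialEquiv_symm]
    refine DifferentiableAt.differentiableWithinAt ?_
    have hopen : IsOpen ((chart m).target ∩ (chart m).symm ⁻¹' {Q | Q.pt ∈ (↑V : X.left.Opens)}) :=
      (chart m).isOpen_inter_preimage_symm (AlgPoints.isOpen_setOf_pt_mem _)
    have hmem : chart m m ∈ (chart m).target ∩ (chart m).symm ⁻¹' {Q | Q.pt ∈ (↑V : X.left.Opens)} :=
      ⟨(chart m).map_source (mem m), by
        simp only [Set.mem_preimage, Set.mem_setOf_eq, (chart m).left_inv (mem m)]; exact hm⟩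
    exact ((hol m V s).differentiableOn (by simp)).differentiableAt (hopen.mem_nhds hmem)
  have hmd : ∀ s : Γ(X.left, ↑U), MDifferentiableOn 𝓘(ℂ, Fin n → ℂ) 𝓘(ℂ, ℂ) (evalOrZero ↑U s)
      {Q : ComplexPoints X | Q.pt ∈ (↑U : X.left.Opens)} := fun s ↦
    hid.mdifferentiableOn_evalOrZero U s
  -- `Z(ℂ) ∩ D(h h')(ℂ) = {g = 0}`
  have hbasic : ∀ (Q : ComplexPoints X) (hQ : Q.pt ∈ (↑U : X.left.Opens)) (f : Γ(X.left, ↑U)),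
      Q.pt ∈ X.left.basicOpen f ↔ f ∉ (hU.primeIdealOf ⟨Q.pt, hQ⟩).asIdeal := fun Q hQ f ↦
    mem_basicOpen_iff_notMem_primeIdealOf hU ⟨Q.pt, hQ⟩ f
  have hevalmem : ∀ (Q : ComplexPoints X) (hQ : Q.pt ∈ (↑U : X.left.Opens)) (f : Γ(X.left, ↑U)),
      Q.eval ↑U hQ f = 0 ↔ f ∈ (hU.primeIdealOf ⟨Q.pt, hQ⟩).asIdeal := fun Q hQ f ↦
    not_iff_not.1 ((AlgPoints.pt_mem_basicOpen_iff Q hQ f).symm.trans (hbasic Q hQ f))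
  have hhP' : P.pt ∈ X.left.basicOpen (h * h') := (AlgPoints.pt_mem_basicOpen_iff P hPU _).2 hhP
  have hZeq : ∀ (Q : ComplexPoints X) (hQ : Q.pt ∈ X.left.basicOpen (h * h')),
      Q.pt ∈ Z ↔ ∀ j, Q.eval ↑U (X.left.basicOpen_le _ hQ) (g j) = 0 := by
    intro Q hQ
    have hQU : Q.pt ∈ (↑U : X.left.Opens) := X.left.basicOpen_le _ hQ
    set q := hU.primeIdealOf ⟨Q.pt, hQU⟩ with hqdef
    have hq : hU.fromSpec.base q = Q.pt := hU.fromSpec_primeIdealOf ⟨Q.pt, hQU⟩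
    have hhq : h * h' ∉ q.asIdeal := (hbasic Q hQU _).1 hQ
    have hh'q : h' ∉ q.asIdeal := fun hm ↦ hhq (Ideal.mul_mem_left _ _ hm)
    have hhq' : h ∉ q.asIdeal := fun hm ↦ hhq (Ideal.mul_mem_right _ _ hm)
    calc Q.pt ∈ Z ↔ hU.fromSpec.base q ∈ Z := by rw [hq]
      _ ↔ 𝔭 ≤ q.asIdeal := hiso q hhq'
      _ ↔ ∀ j, g j ∈ q.asIdeal := by
          refine ⟨fun hle j ↦ hle (hg j), fun hgq a ha ↦ ?_⟩
          have h1 : h' * a ∈ q.asIdeal := by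
            refine (Ideal.span_le.2 ?_ : Ideal.span (Set.range g) ≤ q.asIdeal) (hgen a ha)
            rintro _ ⟨j, rfl⟩
            exact hgq j
          exact (Ideal.IsPrime.mem_or_mem q.2 h1).resolve_left hh'q
      _ ↔ ∀ j, Q.eval ↑U hQU (g j) = 0 := by
          rw [hqdef]
          exact forall_congr' fun j ↦ (hevalmem Q hQU (g j)).symm
  -- the hypotheses of `isRegularPointOfCodim_of_simplePoint`, with `ℂ`-coefficients as scalars
  have htspan' : ∀ a ∈ RingHom.ker (P.evalRingHom ↑U hPU), ∃ coef : Fin n → ℂ,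
      a - ∑ i, SchemeOver.scalarRingHom X ↑U (coef i) * t i ∈
        RingHom.ker (P.evalRingHom ↑U hPU) ^ 2 := by
    intro a ha
    obtain ⟨coef, hcoef⟩ := htspan a (hkerψ ▸ ha)
    refine ⟨coef, ?_⟩
    simp only [Algebra.smul_def] at hcoef
    exact hcoef
  have hg' : ∀ j, g j ∈ RingHom.ker (P.evalRingHom ↑U hPU) := fun j ↦ h𝔭𝔪 (hg j)
  have hindep' : ∀ coef : Fin c → ℂ,
      ∑ j, SchemeOver.scalarRingHom X ↑U (coef j) * g j ∈ RingHom.ker (P.evalRingHom ↑U hPU) ^ 2 →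
        coef = 0 := by
    intro coef hmem
    refine hindep coef ?_
    simp only [Algebra.smul_def]
    exact hmem
  -- `P` is a regular point of codimension `c` of `Z(ℂ)` in the model, hence straightened
  have hregP : Literature.Geometry.Kaehler.IsRegularPointOfCodim 𝓘(ℂ, Fin n → ℂ)
      {Q : ComplexPoints X | Q.pt ∈ Z} c P :=
    isRegularPointOfCodim_of_simplePoint (chart P) rfl (mem P) (hol P) (alg P) U hPU hmd t htspan'
      g hg' hindep' (h * h') hhP' Z hZeq
  obtain ⟨K, e, hPe, he⟩ := hregP.exists_straightening
  exact ⟨K, e, hPe, he⟩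

end Point

/-! ### The closed exceptional set and the global statement -/

section Global

variable {n : ℕ} {X : SchemeOver ℂ}

/-- **Off a closed subset of larger codimension, a Zariski-closed subset is locally flat in
`X(ℂ)`** (Serre, GAGA §6 Cor. 3 at simple points; the algebraic case of Voisin I Thm. 11.11, one
step) — the statement of `exists_closed_straightening_off` (`ZariskiClosedStraightening`) with
"smooth projective" weakened to what its proof uses: `X` an integral `ℂ`-scheme smooth of relative
dimension `n` over `ℂ` (e.g. a smooth irreducible quasi-projective variety, or the total space of a
smooth family over one). Let `Z ⊆ X` be Zariski-closed with every point of codimension `≥ c`. Then there is a Zariski-closed `Z₁ ⊆ Z` with every point of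
codimension `≥ c + 1` such that for every complex point `P` with `pt P ∈ Z ∖ Z₁` there are
`c' ≥ c`, a subspace `K ⊆ ℂⁿ` and an open partial homeomorphism `e : X(ℂ) ⇀ ℂ^{c'} × K` (strong
topology) with `P ∈ e.source` and `pt Q ∈ Z ↔ (e Q).1 = 0` for `Q ∈ e.source`. `Z₁` is the set
of points of `Z` that are not GOOD, a point being good when, in some standard smooth affine chart,
it lies on `V(𝔭) ∩ D(h h')` for a prime `𝔭 ⊇ I(Z ∩ U)` isolated off `V(h)` with generators off
`V(h')`, at a smooth point of `A/𝔭` (`exists_straightening_of_witnesses`); good points form an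
open subset of `Z` (the smooth locus is open, Mathlib `Algebra.isOpen_smoothLocus`) containing
every maximal point of `Z` (generic smoothness, `isSmoothAt_bot`; `exists_minimalPrime_forall_iff`,
`exists_mul_mem_span_of_isRegularLocalRing`), whence the codimension bound.
[cite: SerreGAGA1956, §6 Prop. 3 Cor. 2–3 (p. 11) with §1 n°4 and §2 n°6 Cor. 2]
[cite: VoisinHodgeI2002, §11.1.1 Thm. 11.11] [cite: GortzWedhorn2020, Thm. 6.19 and Lemma 6.26] -/
theorem exists_closed_straightening_off_of_smooth [IsIntegral X.left]
    [SmoothOfRelativeDimension n X.hom] {Z : Set X.left}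
    (hZ : IsClosed Z) {c : ℕ} (hcZ : ∀ z ∈ Z, (c : ℕ∞) ≤ Order.coheight z) :
    ∃ Z₁ : Set X.left, IsClosed Z₁ ∧ Z₁ ⊆ Z ∧
      (∀ z ∈ Z₁, ((c + 1 : ℕ) : ℕ∞) ≤ Order.coheight z) ∧
      ∀ P : ComplexPoints X, P.pt ∈ Z → P.pt ∉ Z₁ →
        ∃ (c' : ℕ) (K : Submodule ℂ (Fin n → ℂ))
          (e : OpenPartialHomeomorph (ComplexPoints X) ((Fin c' → ℂ) × K)),
          c ≤ c' ∧ P ∈ e.source ∧ ∀ Q ∈ e.source, Q.pt ∈ Z ↔ (e Q).1 = 0 := by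
  classical
  -- instances on `X`
  haveI : LocallyOfFiniteType X.hom := by
    haveI : Smooth X.hom := SmoothOfRelativeDimension.smooth n _
    infer_instance
  -- ring-theoretic instances on a standard smooth affine chart
  have chartInst : ∀ (U : X.left.affineOpens), (↑(↑U : X.left.Opens) : Set X.left).Nonempty →
      RingHom.IsStandardSmoothOfRelativeDimension n (SchemeOver.scalarRingHom X ↑U) →
      letI : Algebra ℂ Γ(X.left, ↑U) := (SchemeOver.scalarRingHom X ↑U).toAlgebra
      IsDomain Γ(X.left, ↑U) ∧ Algebra.IsStandardSmoothOfRelativeDimension n ℂ Γ(X.left, ↑U) ∧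
        Algebra.FiniteType ℂ Γ(X.left, ↑U) ∧ IsNoetherianRing Γ(X.left, ↑U) := by
    intro U hne hsm
    letI : Algebra ℂ Γ(X.left, ↑U) := (SchemeOver.scalarRingHom X ↑U).toAlgebra
    haveI : Algebra.IsStandardSmoothOfRelativeDimension n ℂ Γ(X.left, ↑U) := hsm
    obtain ⟨z, hz⟩ := hne
    haveI : Nonempty (↑U : X.left.Opens) := ⟨⟨z, hz⟩⟩
    haveI : IsDomain Γ(X.left, ↑U) := IsIntegral.component_integral (↑U : X.left.Opens)
    haveI : Algebra.IsStandardSmooth ℂ Γ(X.left, ↑U) :=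
      Algebra.IsStandardSmoothOfRelativeDimension.isStandardSmooth n
    haveI : Algebra.FiniteType ℂ Γ(X.left, ↑U) := inferInstance
    exact ⟨inferInstance, hsm, inferInstance, Algebra.FiniteType.isNoetherianRing ℂ _⟩
  -- the good points
  let Good : X.left → Prop := fun z ↦ ∃ (U : X.left.affineOpens) (hzU : z ∈ (↑U : X.left.Opens))
    (_ : RingHom.IsStandardSmoothOfRelativeDimension n (SchemeOver.scalarRingHom X ↑U))
    (𝔭 : Ideal Γ(X.left, ↑U)) (_ : 𝔭.IsPrime) (c' : ℕ) (_ : (c' : ℕ∞) = 𝔭.height)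
    (g : Fin c' → Γ(X.left, ↑U)) (_ : ∀ j, g j ∈ 𝔭) (h h' : Γ(X.left, ↑U))
    (_ : ∀ a ∈ 𝔭, h' * a ∈ Ideal.span (Set.range g))
    (_ : ∀ q : PrimeSpectrum Γ(X.left, ↑U), h ∉ q.asIdeal →
      (U.2.fromSpec.base q ∈ Z ↔ 𝔭 ≤ q.asIdeal))
    (x : PrimeSpectrum (Γ(X.left, ↑U) ⧸ 𝔭)),
    x.asIdeal.comap (Ideal.Quotient.mk 𝔭) = (U.2.primeIdealOf ⟨z, hzU⟩).asIdeal ∧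
    (letI : Algebra ℂ Γ(X.left, ↑U) := (SchemeOver.scalarRingHom X ↑U).toAlgebra;
      x ∈ Algebra.smoothLocus ℂ (Γ(X.left, ↑U) ⧸ 𝔭)) ∧
    h * h' ∉ (U.2.primeIdealOf ⟨z, hzU⟩).asIdeal ∧ c ≤ c'
  -- (1) good points are straightened
  have hstraight : ∀ P : ComplexPoints X, Good P.pt →
      ∃ (c' : ℕ) (K : Submodule ℂ (Fin n → ℂ))
        (e : OpenPartialHomeomorph (ComplexPoints X) ((Fin c' → ℂ) × K)),
        c ≤ c' ∧ P ∈ e.source ∧ ∀ Q ∈ e.source, Q.pt ∈ Z ↔ (e Q).1 = 0 := by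
    rintro P ⟨U, hPU, hsm, 𝔭, h𝔭, c', hc', g, hg, h, h', hgen, hiso, x, hx, hxsm, hhh', hcc'⟩
    letI : Algebra ℂ Γ(X.left, ↑U) := (SchemeOver.scalarRingHom X ↑U).toAlgebra
    obtain ⟨_, _, _, _⟩ := chartInst U ⟨P.pt, hPU⟩ hsm
    haveI : Algebra.FiniteType ℂ (Γ(X.left, ↑U) ⧸ 𝔭) :=
      Algebra.FiniteType.of_surjective (Ideal.Quotient.mkₐ ℂ 𝔭) Ideal.Quotient.mk_surjective
    haveI : Algebra.FinitePresentation ℂ (Γ(X.left, ↑U) ⧸ 𝔭) :=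
      (Algebra.FinitePresentation.of_finiteType).mp ‹_›
    have hreg := isRegularLocalRing_of_mem_smoothLocus ℂ (Γ(X.left, ↑U) ⧸ 𝔭) x hxsm
    have hhP : P.eval ↑U hPU (h * h') ≠ 0 := by
      intro h0
      apply hhh'
      rw [← ker_evalRingHom_eq_primeIdealOf U.2 P hPU, RingHom.mem_ker, AlgPoints.evalRingHom_apply]
      exact h0
    obtain ⟨K, e, hPe, he⟩ := exists_straightening_of_witnesses_of_smooth U hsm 𝔭 hc' g hg h h' hgen hiso
      P hPU x (hx.trans (ker_evalRingHom_eq_primeIdealOf U.2 P hPU).symm) hreg hhP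
    exact ⟨c', K, e, hcc', hPe, he⟩
  -- (2) the good points of `Z` form an open subset of `Z`
  have hopen : ∀ z, Good z → ∃ O : Set X.left, IsOpen O ∧ z ∈ O ∧ ∀ y ∈ O, y ∈ Z → Good y := by
    rintro z ⟨U, hzU, hsm, 𝔭, h𝔭, c', hc', g, hg, h, h', hgen, hiso, x, hx, hxsm, hhh', hcc'⟩
    have hU : IsAffineOpen (↑U : X.left.Opens) := U.2
    letI : Algebra ℂ Γ(X.left, ↑U) := (SchemeOver.scalarRingHom X ↑U).toAlgebra
    obtain ⟨_, _, _, _⟩ := chartInst U ⟨z, hzU⟩ hsm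
    haveI : Algebra.FiniteType ℂ (Γ(X.left, ↑U) ⧸ 𝔭) :=
      Algebra.FiniteType.of_surjective (Ideal.Quotient.mkₐ ℂ 𝔭) Ideal.Quotient.mk_surjective
    haveI : Algebra.FinitePresentation ℂ (Γ(X.left, ↑U) ⧸ 𝔭) :=
      (Algebra.FinitePresentation.of_finiteType).mp ‹_›
    -- the open set: `D(h h')` minus the (closed) image of the non-smooth locus of `A/𝔭`
    set Bad : Set (PrimeSpectrum Γ(X.left, ↑U)) :=
      PrimeSpectrum.comap (Ideal.Quotient.mk 𝔭) '' (Algebra.smoothLocus ℂ (Γ(X.left, ↑U) ⧸ 𝔭))ᶜ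
      with hBad
    have hBadcl : IsClosed Bad :=
      (PrimeSpectrum.isClosedEmbedding_comap_of_surjective _ _ Ideal.Quotient.mk_surjective).isClosedMap
        _ Algebra.isOpen_smoothLocus.isClosed_compl
    set W : Set (PrimeSpectrum Γ(X.left, ↑U)) :=
      (PrimeSpectrum.basicOpen (h * h') : Set (PrimeSpectrum Γ(X.left, ↑U))) ∩ Badᶜ with hW
    have hWo : IsOpen W := (PrimeSpectrum.basicOpen (h * h')).2.inter hBadcl.isOpen_compl
    refine ⟨hU.fromSpec.base '' W, hU.fromSpec.isOpenEmbedding.isOpenMap _ hWo, ?_, ?_⟩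
    · -- `z ∈ O`
      refine ⟨hU.primeIdealOf ⟨z, hzU⟩, ⟨?_, ?_⟩, hU.fromSpec_primeIdealOf ⟨z, hzU⟩⟩
      · exact (PrimeSpectrum.mem_basicOpen _ _).2 hhh'
      · rintro ⟨y, hy, hyq⟩
        apply hy
        have hyx : y = x := PrimeSpectrum.comap_injective_of_surjective _ Ideal.Quotient.mk_surjective
          (by rw [hyq]; exact PrimeSpectrum.ext hx.symm)
        rw [hyx]
        exact hxsm
    · -- every point of `O ∩ Z` is good, with the same witnesses
      rintro y ⟨q', hq'W, rfl⟩ hyZ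
      have hyU : hU.fromSpec.base q' ∈ (↑U : X.left.Opens) := by
        have hr : hU.fromSpec.base q' ∈ Set.range hU.fromSpec := ⟨q', rfl⟩
        rwa [hU.range_fromSpec] at hr
      have hq' : hU.primeIdealOf ⟨hU.fromSpec.base q', hyU⟩ = q' :=
        hU.fromSpec.isOpenEmbedding.injective (hU.fromSpec_primeIdealOf ⟨_, hyU⟩)
      have hhq' : h * h' ∉ q'.asIdeal := (PrimeSpectrum.mem_basicOpen _ _).1 hq'W.1
      have hhq'₁ : h ∉ q'.asIdeal := fun hm ↦ hhq' (Ideal.mul_mem_right _ _ hm)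
      have h𝔭q' : 𝔭 ≤ q'.asIdeal := (hiso q' hhq'₁).1 hyZ
      have hker : RingHom.ker (Ideal.Quotient.mk 𝔭) ≤ q'.asIdeal := by rwa [Ideal.mk_ker]
      let x' : PrimeSpectrum (Γ(X.left, ↑U) ⧸ 𝔭) :=
        ⟨q'.asIdeal.map (Ideal.Quotient.mk 𝔭),
          Ideal.map_isPrime_of_surjective Ideal.Quotient.mk_surjective hker⟩
      have hx' : x'.asIdeal.comap (Ideal.Quotient.mk 𝔭) = q'.asIdeal := by
        change (q'.asIdeal.map (Ideal.Quotient.mk 𝔭)).comap (Ideal.Quotient.mk 𝔭) = q'.asIdeal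
        rw [Ideal.comap_map_of_surjective _ Ideal.Quotient.mk_surjective,
          ← RingHom.ker_eq_comap_bot, Ideal.mk_ker]
        exact sup_eq_left.2 h𝔭q'
      have hx'sm : x' ∈ Algebra.smoothLocus ℂ (Γ(X.left, ↑U) ⧸ 𝔭) := by
        by_contra hns
        exact hq'W.2 ⟨x', hns, PrimeSpectrum.ext hx'⟩
      refine ⟨U, hyU, hsm, 𝔭, h𝔭, c', hc', g, hg, h, h', hgen, hiso, x', ?_, hx'sm, ?_, hcc'⟩
      · rw [hq']
        exact hx'
      · rw [hq']
        exact hhq'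
  -- (3) maximal points of `Z` are good
  have hmaximal : ∀ η ∈ Z, (∀ y ∈ Z, y ⤳ η → y = η) → Good η := by
    intro η hηZ hmax
    -- a standard smooth affine chart `U = Spec A ∋ η`
    obtain ⟨U₀, hU, hηU, hsm⟩ := exists_isStandardSmoothOfRelativeDimension_scalarRingHom' X n η
    let U : X.left.affineOpens := ⟨U₀, hU⟩
    letI : Algebra ℂ Γ(X.left, ↑U) := (SchemeOver.scalarRingHom X ↑U).toAlgebra
    obtain ⟨_, _, _, _⟩ := chartInst U ⟨η, hηU⟩ hsm
    -- the ideal of `Z ∩ U` and the prime of `η`, a minimal prime of it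
    set I : Ideal Γ(X.left, ↑U) := PrimeSpectrum.vanishingIdeal (hU.fromSpec.base ⁻¹' Z) with hIdef
    have hZI : ∀ q : PrimeSpectrum Γ(X.left, ↑U), hU.fromSpec.base q ∈ Z ↔ I ≤ q.asIdeal :=
      fromSpec_mem_iff_vanishingIdeal_le hU hZ
    set qη : PrimeSpectrum Γ(X.left, ↑U) := hU.primeIdealOf ⟨η, hηU⟩ with hqηdef
    have hqη : hU.fromSpec.base qη = η := hU.fromSpec_primeIdealOf ⟨η, hηU⟩
    have hIq : I ≤ qη.asIdeal := (hZI qη).1 (by rw [hqη]; exact hηZ)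
    have hqmin : ∀ q : PrimeSpectrum Γ(X.left, ↑U), I ≤ q.asIdeal → q.asIdeal ≤ qη.asIdeal →
        qη.asIdeal ≤ q.asIdeal := by
      intro q hIq' hle
      have hyZ : hU.fromSpec.base q ∈ Z := (hZI q).2 hIq'
      have hspec : hU.fromSpec.base q ⤳ η := by
        rw [← hqη]
        exact ((PrimeSpectrum.le_iff_specializes q qη).1 hle).map hU.fromSpec.base.hom.continuous
      have heq : q = qη := hU.fromSpec.isOpenEmbedding.injective ((hmax _ hyZ hspec).trans hqη.symm)
      rw [heq]
    -- `qη` isolated off `V(h)`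
    obtain ⟨𝔭', h𝔭'min, h𝔭'le, h, hh𝔭', hiso'⟩ :=
      exists_minimalPrime_forall_iff I qη.asIdeal hIq
    have h𝔭'eq : 𝔭' = qη.asIdeal :=
      le_antisymm h𝔭'le (hqmin ⟨𝔭', h𝔭'min.1.1⟩ h𝔭'min.1.2 h𝔭'le)
    have hhq : h ∉ qη.asIdeal := h𝔭'eq ▸ hh𝔭'
    have hiso : ∀ q : PrimeSpectrum Γ(X.left, ↑U), h ∉ q.asIdeal →
        (hU.fromSpec.base q ∈ Z ↔ qη.asIdeal ≤ q.asIdeal) := fun q hq ↦ by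
      rw [hZI q, ← h𝔭'eq]
      exact hiso' q.asIdeal q.2 hq
    -- generators of `qη` off `V(h')`
    set 𝔭 : Ideal Γ(X.left, ↑U) := qη.asIdeal with h𝔭def
    haveI h𝔭prime : 𝔭.IsPrime := qη.2
    obtain ⟨c', hc'⟩ : ∃ c' : ℕ, 𝔭.height = c' := by
      obtain ⟨c', hc'⟩ := ENat.ne_top_iff_exists.mp (Ideal.height_ne_top_of_isPrime (I := 𝔭))
      exact ⟨c', hc'.symm⟩
    haveI := Literature.AlgebraicGeometry.Motives.isRegularLocalRing_of_isStandardSmoothOfRelativeDimension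
      ℂ n 𝔭
    have hdim𝔭 : ringKrullDim (Localization.AtPrime 𝔭) = c' := by
      rw [IsLocalization.AtPrime.ringKrullDim_eq_height 𝔭, hc']
      rfl
    obtain ⟨g, hg, h', hh', hgen⟩ := exists_mul_mem_span_of_isRegularLocalRing 𝔭 hdim𝔭
    -- the generic point of `A/𝔭` is smooth
    haveI : IsDomain (Γ(X.left, ↑U) ⧸ 𝔭) := Ideal.Quotient.isDomain 𝔭
    haveI : Algebra.FiniteType ℂ (Γ(X.left, ↑U) ⧸ 𝔭) :=
      Algebra.FiniteType.of_surjective (Ideal.Quotient.mkₐ ℂ 𝔭) Ideal.Quotient.mk_surjective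
    let x : PrimeSpectrum (Γ(X.left, ↑U) ⧸ 𝔭) := ⟨⊥, Ideal.isPrime_bot⟩
    have hx : x.asIdeal.comap (Ideal.Quotient.mk 𝔭) = qη.asIdeal := by
      change (⊥ : Ideal (Γ(X.left, ↑U) ⧸ 𝔭)).comap (Ideal.Quotient.mk 𝔭) = 𝔭
      rw [← RingHom.ker_eq_comap_bot, Ideal.mk_ker]
    have hxsm : x ∈ Algebra.smoothLocus ℂ (Γ(X.left, ↑U) ⧸ 𝔭) := isSmoothAt_bot ℂ (Γ(X.left, ↑U) ⧸ 𝔭)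
    -- the height of `qη` is the codimension of `η`
    have hcc' : c ≤ c' := by
      have h3 : (c : ℕ∞) ≤ Order.coheight (hU.fromSpec.base qη) := by
        rw [hqη]
        exact hcZ η hηZ
      rw [coheight_eq_of_isOpenImmersion hU.fromSpec, ← idealHeight_eq_coheight _ qη,
        show qη.asIdeal = 𝔭 from rfl, hc'] at h3
      exact_mod_cast h3
    refine ⟨U, hηU, hsm, 𝔭, h𝔭prime, c', hc'.symm, g, hg, h, h', hgen, hiso, x, hx, hxsm, ?_, hcc'⟩
    exact fun hm ↦ (Ideal.IsPrime.mem_or_mem inferInstance hm).elim hhq hh'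
  -- the exceptional set
  choose O hO using hopen
  refine ⟨{z | z ∈ Z ∧ ¬Good z}, ?_, fun z hz ↦ hz.1, ?_, ?_⟩
  · -- closed: `Z ∖ ⋃ O`
    have heq : {z | z ∈ Z ∧ ¬Good z} = Z ∩ (⋃ (z : X.left) (hz : Good z), O z hz)ᶜ := by
      ext y
      simp only [Set.mem_setOf_eq, Set.mem_inter_iff, Set.mem_compl_iff, Set.mem_iUnion, not_exists]
      constructor
      · rintro ⟨hyZ, hy⟩
        exact ⟨hyZ, fun z hz hyO ↦ hy ((hO z hz).2.2 y hyO hyZ)⟩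
      · rintro ⟨hyZ, hy⟩
        exact ⟨hyZ, fun hyg ↦ hy y hyg (hO y hyg).2.1⟩
    rw [heq]
    exact hZ.inter (isOpen_iUnion fun z ↦ isOpen_iUnion fun hz ↦ (hO z hz).1).isClosed_compl
  · -- codimension `≥ c + 1`
    rintro z ⟨hzZ, hzbad⟩
    -- a maximal point `η` of `Z` specialising to `z`: minimise the codimension
    let S : Set X.left := {y | y ∈ Z ∧ y ⤳ z}
    have hzS : z ∈ S := ⟨hzZ, specializes_rfl⟩
    let η : X.left := Function.argminOn (fun y ↦ Order.coheight y) S ⟨z, hzS⟩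
    obtain ⟨hηZ, hηz⟩ : η ∈ S := Function.argminOn_mem _ S ⟨z, hzS⟩
    have hmin : ∀ y ∈ S, Order.coheight η ≤ Order.coheight y := fun y hy ↦
      Function.argminOn_le (fun y ↦ Order.coheight y) S hy
    have hfin : ∀ y : X.left, Order.coheight y ≠ ⊤ := fun y hy ↦ by
      have h := Motives.height_add_coheight_eq_of_smoothOfRelativeDimension X.hom n y
      rw [hy, add_top] at h
      exact ENat.top_ne_coe n h
    have hmax : ∀ y ∈ Z, y ⤳ η → y = η := by
      intro y hyZ hyη
      by_contra hne
      have hyS : y ∈ S := ⟨hyZ, hyη.trans hηz⟩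
      have hlt : η < y := lt_of_le_not_ge (Scheme.le_iff_specializes.2 hyη)
        fun hle ↦ hne (hyη.antisymm (Scheme.le_iff_specializes.1 hle)).eq
      have h1 := Order.coheight_add_one_le hlt
      have h2 := hmin y hyS
      obtain ⟨k, hk⟩ := ENat.ne_top_iff_exists.mp (hfin y)
      rw [← hk] at h1 h2
      have h3 : (k : ℕ∞) + 1 ≤ k := h1.trans h2
      exact absurd (by exact_mod_cast h3 : k + 1 ≤ k) (by omega)
    have hηgood : Good η := hmaximal η hηZ hmax
    have hne : z ≠ η := fun h ↦ hzbad (h ▸ hηgood)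
    have hlt : z < η := lt_of_le_not_ge (Scheme.le_iff_specializes.2 hηz)
      fun hle ↦ hne ((Scheme.le_iff_specializes.1 hle).antisymm hηz).eq
    have h1 := Order.coheight_add_one_le hlt
    have h2 : (c : ℕ∞) + 1 ≤ Order.coheight η + 1 := add_le_add (hcZ η hηZ) le_rfl
    have h3 := h2.trans h1
    exact_mod_cast h3
  · -- straightening off the exceptional set
    intro P hPZ hP
    have hgood : Good P.pt := by
      by_contra hng
      exact hP ⟨hPZ, hng⟩
    exact hstraight P hgood

end Global

end GAGADimension

end Literature.AlgebraicGeometry.HodgeTheory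

end
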